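import Summits.ResolutionOfSingularities.KangarooAtlas.MizutaniHSchemeCriterion
import HarnessLib

/-!
# Mizutani's condition (iii): the subspaces `N_{e+1}` of the Hironaka schemes of exponent EXACTLY `e + 1`

Cell `pub-rosobs`, Mizutani enclosure (seat mizutani-encloser-1, gen 9).  AI-written; *AI review is weaker than
expert review*; NOT a resolution-of-singularities theorem (summit relevance C).

Mizutani 1973 (*) (iii): the pair `(V, W)` at level `e ≥ 1` gives an H-scheme of exponent exactly `e` iff
`V ⊄ k·(V ∩ (k^p ⊗_{k^q} W))`, i.e. `V` is NOT spanned by its vectors with coordinates in `k^p` (Remark 1.4: then (ii) is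
automatic).  On top of `MizutaniHSchemeCriterion.lean` ((i), (ii)):

* `image_frobVec_invForms_eq` — `F((L_B)_e) = (L_B)_{e+1} ∩ F(k^{n+1})` (level radical `mem_invForms_iff_frobVec_mem`);
* **`exponentLE_iff_eq_span_inter_range`** — for a point with exponent `≤ e + 1`: exponent `≤ e` iff `(L_B)_{e+1}` is spanned by
  its vectors with coordinates in `k^p`;
* **`exists_isPoint_exponent_eq_succ_iff`** — `V ⊆ k^{n+1}` is `(L_B)_{e+1}(𝔭)` of a point `𝔭` with `exponent B(𝔭) = e + 1`
  iff `V ≠ ⊤ ∧ 𝒥_{e+1}𝒟_{e+1}(V) = V ∧ V ≠ span_k(V ∩ F(k^{n+1}))` — (*) (i)(ii)(iii) ⟺ H-scheme of exponent `e + 1`.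

References: H. Mizutani, Nagoya Math. J. 52 (1973), (*) (iii), Remark 1.4, Thm. 1.3 [Mizutani1973HironakaGroupSchemes];
T. Oda, Publ. RIMS 19 (1983), Cor. 2.3 («exponent(B) ≤ e iff V is defined over F^{−e}(k)») [Oda1983HironakaGroupSchemeII].
-/

noncomputable section

open MvPolynomial Literature.AlgebraicGeometry.Resolution Literature.AlgebraicGeometry.Resolution.HironakaScheme
  Literature.RingTheory.MvPolynomial Literature.RingTheory.HilbertSamuel

namespace Summit.ResolutionOfSingularities.KangarooAtlas.Mizutani

universe u

/-! ## Condition (iii): exponent exactly `e + 1` -/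

section Exact

variable (k : Type u) [Field k] (p : ℕ) [hp : Fact p.Prime] [CharP k p] {n : ℕ}
  (𝔭 : Ideal (MvPolynomial (Fin (n + 1)) k)) (e : ℕ)

/-- `F((L_B)_e) = (L_B)_{e+1} ∩ F(k^{n+1})`: the vectors of `(L_B)_{e+1}` with coordinates in `k^p` are exactly the `p`-th powers
of vectors of `(L_B)_e` (level radical). [cite: Mizutani1973HironakaGroupSchemes, Thm. 1.3 (N = rad_L(k[F]N_e))] -/
theorem image_frobVec_invForms_eq [𝔭.IsPrime] (hP : IsPoint k 𝔭) :
    frobVec k p 1 '' (invForms k p 𝔭 e : Set (Fin (n + 1) → k)) =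
      (invForms k p 𝔭 (e + 1) : Set (Fin (n + 1) → k)) ∩ Set.range (frobVec k p 1) := by
  ext b
  constructor
  · rintro ⟨a, ha, rfl⟩
    exact ⟨(mem_invForms_iff_frobVec_mem k p 𝔭 hP e 1 a).mp ha, a, rfl⟩
  · rintro ⟨hb, a, rfl⟩
    exact ⟨a, (mem_invForms_iff_frobVec_mem k p 𝔭 hP e 1 a).mpr hb, rfl⟩

/-- **Mizutani's (iii), for a point of exponent `≤ e + 1`: `exponent ≤ e` iff `V = (L_B)_{e+1}` is spanned by its vectors with
coordinates in `k^p`** («`V ⊆ k·(V ∩ (k^p ⊗_{k^q} W))`», i.e. `V` is defined over `k^p`).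
[cite: Mizutani1973HironakaGroupSchemes, (*) (iii) and Remark 1.4] -/
theorem exponentLE_iff_eq_span_inter_range [𝔭.IsPrime] (hP : IsPoint k 𝔭) (hE : ExponentLE k p 𝔭 (e + 1)) :
    ExponentLE k p 𝔭 e ↔ invForms k p 𝔭 (e + 1) =
      Submodule.span k ((invForms k p 𝔭 (e + 1) : Set (Fin (n + 1) → k)) ∩ Set.range (frobVec k p 1)) := by
  rw [← image_frobVec_invForms_eq k p 𝔭 e hP]
  constructor
  · intro h
    have := h (e + 1) (Nat.le_succ e)
    rwa [Nat.add_sub_cancel_left] at this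
  · intro h
    exact exponentLE_of_succ_eq k p 𝔭 hE h

/-- **THM 1.3 / (*) (i)(ii)(iii) FOR EXPONENT EXACTLY `e + 1`**: `V ⊆ k^{n+1}` is `(L_B)_{e+1}(𝔭)` of a point with
`exponent B(𝔭) = e + 1` iff `V ≠ ⊤`, `𝒥_{e+1}𝒟_{e+1}(V) = V`, and `V` is NOT spanned by its vectors with coordinates in `k^p`.
AI-written; *AI review is weaker than expert review*; not a resolution theorem.
[cite: Mizutani1973HironakaGroupSchemes, Thm. 1.3, (*) (i)–(iii)] -/
theorem exists_isPoint_exponent_eq_succ_iff (V : Submodule k (Fin (n + 1) → k)) :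
    (∃ 𝔭 : Ideal (MvPolynomial (Fin (n + 1)) k), IsPoint k 𝔭 ∧ exponent k p 𝔭 = e + 1 ∧ invForms k p 𝔭 (e + 1) = V) ↔
      (V ≠ ⊤ ∧ jCore k p (e + 1) (dSpan k p (e + 1) V) = V ∧
        V ≠ Submodule.span k ((V : Set (Fin (n + 1) → k)) ∩ Set.range (frobVec k p 1))) := by
  constructor
  · rintro ⟨𝔭, hP, hexp, rfl⟩
    haveI := hP.1
    have hE : ExponentLE k p 𝔭 (e + 1) := (exponent_le_iff k p 𝔭).mp hexp.le
    refine ⟨invForms_ne_top k p (e + 1) 𝔭 hP, jCore_dSpan_invForms k p 𝔭 (e + 1), fun h => ?_⟩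
    have hle : exponent k p 𝔭 ≤ e :=
      (exponent_le_iff k p 𝔭).mpr ((exponentLE_iff_eq_span_inter_range k p 𝔭 e hP hE).mpr h)
    omega
  · rintro ⟨hne, hV, hiii⟩
    set 𝔤 := qLinPoint k p (e + 1) (dSpan k p (e + 1) V) with h𝔤
    haveI := isPrime_qLinPoint k p (e + 1) (dSpan k p (e + 1) V)
    obtain ⟨hG, hE, hinv, -⟩ := qLinPoint_dSpan_realises k p (e + 1) hne hV
    refine ⟨𝔤, hG, le_antisymm ((exponent_le_iff k p 𝔤).mpr hE) ?_, hinv⟩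
    by_contra hlt
    push Not at hlt
    have hle : ExponentLE k p 𝔤 e := (exponent_le_iff k p 𝔤).mp (by omega)
    apply hiii
    have := (exponentLE_iff_eq_span_inter_range k p 𝔤 e hG hE).mp hle
    rwa [hinv] at this

end Exact

end Summit.ResolutionOfSingularities.KangarooAtlas.Mizutani

end
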